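import Summits.BirchSwinnertonDyer.BirchSwinnertonDyer.Theorems.CMKolyvaginAtInertTwoInertOrderSplittingHabitat
import HarnessLib

/-!
# Route `CMKolyvaginAtInertTwo`, crux `CMKolyvaginExactAtInertTwo` (stmt-BirchSwinnertonDyer-24277):
# the CM generator of the ORDER OF CONDUCTOR `3` (`j = −12288000`, the twists of `27a4`) — an
# equivariant `η` with `η² + 9η = −27` on `E_K(K̄)` for every number field `K ∋ √Δ_E`
# (part 4 of `CMKolyvaginCartanCommuteAtTwo{,Level,Classes}`; the splitting package is part 5,
# `CMKolyvaginCartanCommuteAtTwoTwentySevenA4Splitting`)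

Cell `bsd-print-cf2`, seat ty2 (discharge interface). HONEST FRAMING: THEOREMS ONLY — no definition,
no named fact, no route file imported, nothing about BSD asserted; no item is closed by this file.

The inert-order splitting of seat `bsd-line-cmk2-p1` g10 (`…InertOrderSplittingHabitat/Conj/H2`: over a
number field `K ∋ √Δ_E`, `H¹(K, E_K[2^M])` is a `ℤ/2^M[η]⟨σ⟩`-module and every finite `σ_*`-,
`η_*`-stable subgroup has square order) takes as input an EQUIVARIANT CM generator `η` on `E_K(K̄)` with
`η² + mη = c`, `m, c` ODD, and supplies it (`exists_cmGenerator_baseChange`) only for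
`j(E) ∈ maximalCMJInvariants` — through the tree's PROVED `ι₀ : ℤ[ω_d] ≅ End_{ℚ̄}(E)`
(`Cox2013_exists_ringEquiv_cmRing_geomEndRing_holds`), stated for the nine MAXIMAL orders. On the
habitat `H₂` (CM, `2` inert, `ρ̄_{E,2}` onto) exactly one class is left out: `j = −12288000 = −2¹⁵·3·5³`,
CM by the order `ℤ[3ζ₃]` of conductor `3` (the quadratic twists of `27a3/27a4`; KERNEL-STATUS v9 §9 (c),
MEMO-inert-order-splitting §5 stub S3). This file supplies it, WITHOUT a Vélu formula for the dual:

* §1 `exists_dualHom_of_surjective` — pure group theory: an onto homomorphism `f : A → B` whose kernel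
  is killed by `n` has a "dual" `g : B → A` with `g ∘ f = n` and `f ∘ g = n` (Silverman III.6.1 for
  isogenies: `φ̂ ∘ φ = [deg φ]`; here `g(f a) := n·a` is well defined).
* §2 `exists_generator_pullback` — for curves `V, V'` over a field `k`, an onto `Γ_k`-equivariant
  `φ : V(k̄) → V'(k̄)` with `ker φ ⊆ V[n]` and an endomorphism `η₀` of `V'(k̄)` with `η₀² + m₀η₀ = c₀`
  satisfying the GALOIS DICHOTOMY (`σ` commutes with `η₀`, or `η₀σ = −ση₀ − m₀σ`) for every `σ ∈ Γ_k`: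
  the pull-back `η = φ̂ η₀ φ` satisfies `η² + n m₀ η = n² c₀` and the same dichotomy with `m = n m₀`.
* §3 `exists_cmGenerator_dichotomy_of_j_eq_neg_12288000` — for EVERY `W/ℚ` with `j(W) = −12288000`:
  an `η` on `E(ℚ̄)` with **`η(ηP) + 9·ηP = −27·P`** (`m = 9`, `c = −27`, both odd; `η = φ̂ ω' φ` with
  `ω'² + 3ω' = −3` Cox's generator `ω' = ω_{−3}` on the `j = 0` quotient, so `η ↔ 3ω'` generates an
  order of conductor `3` in `ℚ(√−3)` in which `2` is inert) and the dichotomy for every `σ ∈ Γ_ℚ`.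
  Route: `W ≅_ℚ E_d = [0, 36d, 0, −48d², 16d³]` (`exists_variableChange_eq_quadraticTwist_of_j_eq`,
  `twistPointsIso`), the kernel-`x` `3`-isogeny `φ : E_d → E'_d = [0, 36d, 0, 432d², 13392d³]`
  (`IsKernelXThreePair.toIsogeny`: onto on `ℚ̄`-points, kernel of order `3`, `Γ_ℚ`-equivariant), Cox's
  `η₀ ∈ End_{ℚ̄}(E'_d)` (`exists_cmGenerator_of_mem_maximalCMJInvariants`, `j(E'_d) = 0`) with its
  dichotomy (`CartanAtTwo.dichotomy`), §2 twice (`n = 3`, then `n = 1` for the `ℚ`-isomorphism);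
  `Δ_neg_of_j_eq_neg_12288000` (`Δ(E_d) = −2¹²3⁵d⁶`).
* §4 `exists_cmGenerator_baseChange_of_j_eq_neg_12288000` — for any number field `K` with
  `Δ_W ∈ K^{×2}`: an EQUIVARIANT such `η` on `E_K(K̄)` (every `γ ∈ Γ_K` is even on `E[2]`,
  `InertOrderSplittingHabitat.smul_trivial_or_fixedPointFree_of_isSquare_Δ`; even elements commute with
  `η` by the dichotomy, `commute_of_trivial` / `commute_of_fixedPointFree`; transport along
  `E(ℚ̄) ≃ E_K(K̄)`) — the `j = −12288000` twin of cmk2's `exists_cmGenerator_baseChange`.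

HONEST SCOPE: `η` is produced as an endomorphism of the abstract `Γ`-module `E(K̄)` (the dual `φ̂` is
DEFINED by `φ̂(φP) = 3P`, §1); that it is an ALGEBRAIC endomorphism (membership in `geomEndRing`, action
on local points) is not proved here and is not needed by the `H¹`-level splitting; a Selmer-level
consumer (MEMO stub S1, `η_*` preserves `Sel_{2^M}`) needs that extra input.
beyond-print theorem: NO (Lang, *Elliptic Functions* Ch. 10 §4 Remark / Silverman III.6.1 bookkeeping
at `2`-power level). BSD is not proved by any of this; no summit statement is proved by this seat.

References: S. Lang, *Elliptic Functions*, GTM 112 (1987), Ch. 10 §4 Remark [Lang1987]; J. H.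
Silverman, *The Arithmetic of Elliptic Curves*, GTM 106 (2009), III.6.1–6.2 (dual isogeny), III.§1,
X.5.4 [SilvermanAEC2009]; D. A. Cox, *Primes of the form x² + ny²* (2013), §7.B (orders), Thm. 14.16
[Cox2013]; J. E. Cremona, *Algorithms* (1997), §3.8 (Vélu) [CremonaAlgorithms1997].
-/

set_option autoImplicit false

noncomputable section

open scoped Classical

namespace Summit.BirchSwinnertonDyer.Rank1Residual.P2.CartanAtTwo

open WeierstrassCurve Field
open Literature.NumberTheory.EllipticCurves
open Literature.NumberTheory.GaloisRepresentations
open Summit.BirchSwinnertonDyer.BirchSwinnertonDyer.Theorems.InertOrderSplittingHabitat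

universe u

/-! ## §1 The dual of an onto homomorphism with `n`-torsion kernel -/

section DualHom

variable {A B : Type*} [AddCommGroup A] [AddCommGroup B]

/-- **The dual homomorphism.** If `f : A → B` is onto and `n` kills `ker f`, then `g(f a) := n·a` is a
well-defined homomorphism `g : B → A` with `g ∘ f = n` and `f ∘ g = n` — the group-theoretic content of
the dual isogeny `φ̂ ∘ φ = [deg φ]`, `φ ∘ φ̂ = [deg φ]`. [cite: SilvermanAEC2009, III.6.1–6.2] -/
theorem exists_dualHom_of_surjective (f : A →+ B) (hf : Function.Surjective f) (n : ℤ)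
    (hker : ∀ a, f a = 0 → n • a = 0) :
    ∃ g : B →+ A, (∀ a, g (f a) = n • a) ∧ ∀ b, f (g b) = n • b := by
  choose s hs using hf
  have key : ∀ (a : A) (b : B), f a = b → n • s b = n • a := fun a b hab ↦ by
    have h0 : f (s b - a) = 0 := by rw [map_sub, hs, hab, sub_self]
    have h := hker _ h0
    rwa [zsmul_sub, sub_eq_zero] at h
  refine ⟨{ toFun := fun b ↦ n • s b, map_zero' := ?_, map_add' := fun b₁ b₂ ↦ ?_ }, fun a ↦ ?_,
    fun b ↦ ?_⟩
  · change n • s 0 = 0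
    rw [key 0 0 (map_zero f), zsmul_zero]
  · change n • s (b₁ + b₂) = n • s b₁ + n • s b₂
    rw [key (s b₁ + s b₂) (b₁ + b₂) (by rw [map_add, hs, hs]), zsmul_add]
  · exact key a (f a) rfl
  · change f (n • s b) = n • b
    rw [map_zsmul, hs]

/-- An element of an additive subgroup of order `n` is killed by `n` (Lagrange). [folklore] -/
theorem zsmul_eq_zero_of_mem_of_natCard_eq {H : AddSubgroup A} {n : ℕ} (hH : Nat.card H = n)
    {a : A} (ha : a ∈ H) : (n : ℤ) • a = 0 := by
  have h := addOrderOf_dvd_natCard (⟨a, ha⟩ : H)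
  rw [hH, addOrderOf_dvd_iff_nsmul_eq_zero] at h
  have h' : n • a = 0 := congrArg Subtype.val h
  rw [natCast_zsmul]
  exact h'

end DualHom

/-! ## §2 Pulling a generator with the Galois dichotomy back along an isogeny -/

section Pullback

variable {k : Type u} [Field k] (V V' : WeierstrassCurve k)

/-- **Pull-back of a CM generator along an onto equivariant homomorphism with `n`-torsion kernel.**
If `φ : V(k̄) → V'(k̄)` is additive, onto, `Γ_k`-equivariant, with `ker φ` killed by `n`, and `η₀` is an
additive endomorphism of `V'(k̄)` with `η₀(η₀Q) + m₀·η₀Q = c₀·Q` such that every `σ ∈ Γ_k` either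
commutes with `η₀` or satisfies `η₀(σQ) = −σ(η₀Q) − m₀·σQ`, then `η := φ̂ ∘ η₀ ∘ φ` (`φ̂` from §1)
satisfies `η(ηP) + m·ηP = c·P` with `m = n·m₀`, `c = n²·c₀`, and the same dichotomy with `m`.
(`η² = φ̂η₀(φφ̂)η₀φ = n·φ̂η₀²φ`.) [cite: Lang1987, Ch. 10 §4, Remark] [cite: SilvermanAEC2009, III.6.1–6.2] -/
theorem exists_generator_pullback (φ : geomPoints V →+ geomPoints V') (hφ : Function.Surjective φ)
    {n : ℤ} (hker : ∀ P, φ P = 0 → n • P = 0)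
    (hφG : ∀ (σ : absoluteGaloisGroup k) (P : geomPoints V), φ (σ • P) = σ • φ P)
    {η₀ : AddMonoid.End (geomPoints V')} {m₀ c₀ m c : ℤ} (hm : n * m₀ = m) (hc : n ^ 2 * c₀ = c)
    (hrel₀ : ∀ Q : geomPoints V', η₀ (η₀ Q) + m₀ • η₀ Q = c₀ • Q)
    (hdich₀ : ∀ σ : absoluteGaloisGroup k,
      (∀ Q : geomPoints V', σ • η₀ Q = η₀ (σ • Q)) ∨
        (∀ Q : geomPoints V', η₀ (σ • Q) = -(σ • η₀ Q) - m₀ • σ • Q)) :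
    ∃ η : AddMonoid.End (geomPoints V),
      (∀ P : geomPoints V, η (η P) + m • η P = c • P) ∧
      ∀ σ : absoluteGaloisGroup k,
        (∀ P : geomPoints V, σ • η P = η (σ • P)) ∨
          (∀ P : geomPoints V, η (σ • P) = -(σ • η P) - m • σ • P) := by
  obtain ⟨g, hgf, hfg⟩ := exists_dualHom_of_surjective φ hφ n hker
  -- `g` is equivariant because `φ` is
  have hgG : ∀ (σ : absoluteGaloisGroup k) (Q : geomPoints V'), g (σ • Q) = σ • g Q := fun σ Q ↦ by
    obtain ⟨P, rfl⟩ := hφ Q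
    rw [← hφG, hgf, hgf, smul_zsmul_geomPoints V n σ P]
  refine ⟨g.comp ((η₀ : geomPoints V' →+ geomPoints V').comp φ), fun P ↦ ?_, fun σ ↦ ?_⟩
  · -- the relation
    change g (η₀ (φ (g (η₀ (φ P))))) + m • g (η₀ (φ P)) = c • P
    rw [hfg, map_zsmul, map_zsmul, ← hm, ← hc]
    have h := hrel₀ (φ P)
    have e1 : g (η₀ (η₀ (φ P))) = g (c₀ • φ P - m₀ • η₀ (φ P)) := by
      rw [eq_sub_of_add_eq h]
    rw [map_sub, map_zsmul, map_zsmul, hgf] at e1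
    rw [e1]
    module
  · rcases hdich₀ σ with h | h
    · left
      intro P
      change σ • g (η₀ (φ P)) = g (η₀ (φ (σ • P)))
      rw [hφG, ← h, hgG]
    · right
      intro P
      change g (η₀ (φ (σ • P))) = -(σ • g (η₀ (φ P))) - m • σ • P
      rw [hφG, h, map_sub, map_neg, hgG, map_zsmul, hgG, hgf, ← hm, smul_zsmul_geomPoints V n σ P,
        smul_smul, mul_comm m₀ n]

end Pullback

/-! ## §3 The class `j = −12288000` over `ℚ`: a generator with `η² + 9η = −27` and its dichotomy -/

section Rational

variable (W : WeierstrassCurve ℚ) [W.IsElliptic]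

/-- The reference model `[0, 36, 0, −48, 16]` (`27a`-class up to twist) is an elliptic curve.
[cite: CremonaAlgorithms1997, Table 1 (N = 27)] -/
private theorem isElliptic_ref : (⟨0, 36, 0, -48, 16⟩ : WeierstrassCurve ℚ).IsElliptic :=
  ⟨isUnit_iff_ne_zero.mpr (by
    norm_num [WeierstrassCurve.Δ, WeierstrassCurve.b₂, WeierstrassCurve.b₄, WeierstrassCurve.b₆,
      WeierstrassCurve.b₈])⟩

/-- `j([0, 36, 0, −48, 16]) = −12288000`. [cite: CremonaAlgorithms1997, Table 1 (N = 27)] -/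
private theorem j_ref : (haveI := isElliptic_ref; (⟨0, 36, 0, -48, 16⟩ : WeierstrassCurve ℚ).j) = -12288000 := by
  haveI := isElliptic_ref
  rw [j, Units.inv_mul_eq_iff_eq_mul, coe_Δ']
  norm_num [WeierstrassCurve.c₄, WeierstrassCurve.Δ, WeierstrassCurve.b₂, WeierstrassCurve.b₄,
    WeierstrassCurve.b₆, WeierstrassCurve.b₈]

/-- **Every `W/ℚ` with `j(W) = −12288000` is `ℚ`-isomorphic to some `E_d = [0, 36d, 0, −48d², 16d³]`,
`d ≠ 0`** (`j ≠ 0, 1728`: quadratic twists of the reference model exhaust the `ℚ`-forms).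
[cite: SilvermanAEC2009, X.5.4 (twists for j ≠ 0, 1728)] -/
theorem exists_variableChange_eq_model_of_j_eq_neg_12288000 (hj : W.j = -12288000) :
    ∃ d : ℚ, d ≠ 0 ∧ ∃ C : VariableChange ℚ,
      C • W = (⟨0, 36 * d, 0, -48 * d ^ 2, 16 * d ^ 3⟩ : WeierstrassCurve ℚ) := by
  haveI := isElliptic_ref
  obtain ⟨d, hd, C, hC⟩ := exists_variableChange_eq_quadraticTwist_of_j_eq
    (W := W) (E := (⟨0, 36, 0, -48, 16⟩ : WeierstrassCurve ℚ)) (by rw [hj, j_ref])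
    (by rw [j_ref]; norm_num) (by rw [j_ref]; norm_num)
  have hV : (⟨0, 36, 0, -48, 16⟩ : WeierstrassCurve ℚ).quadraticTwist d =
      ⟨0, 36 * d, 0, -48 * d ^ 2, 16 * d ^ 3⟩ := by
    ext <;> simp [WeierstrassCurve.quadraticTwist, WeierstrassCurve.b₂, WeierstrassCurve.b₄,
      WeierstrassCurve.b₆] <;> ring
  exact ⟨d, hd, C, by rw [hC, hV]⟩

/-- `Δ(E_d) = −995328·d⁶` for the kernel-`x` model. [cite: SilvermanAEC2009, III.§1] -/
theorem Δ_model (d : ℚ) :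
    (⟨0, 36 * d, 0, -48 * d ^ 2, 16 * d ^ 3⟩ : WeierstrassCurve ℚ).Δ = -995328 * d ^ 6 := by
  simp only [WeierstrassCurve.Δ, WeierstrassCurve.b₂, WeierstrassCurve.b₄, WeierstrassCurve.b₆,
    WeierstrassCurve.b₈]
  ring

/-- **On the kernel-`x` model `E_d = [0, 36d, 0, −48d², 16d³]` (`d ≠ 0`): a generator `η` of the CM
order `ℤ[3ζ₃]`-type with `η(ηP) + 9·ηP = −27·P` and the Galois dichotomy** — pulled back (§2, `n = 3`)
from Cox's generator `η₀` (`η₀² + 3η₀ = −3`) on Vélu's quotient `E'_d = [0, 36d, 0, 432d², 13392d³]`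
(`j = 0`, maximal order `ℤ[ζ₃]`) along the kernel-`x` `3`-isogeny `E_d → E'_d` (onto on `ℚ̄`-points,
kernel of order `3`, defined over `ℚ`). [cite: Lang1987, Ch. 10 §4, Remark]
[cite: CremonaAlgorithms1997, §3.8 (Vélu's formulae)] [cite: Cox2013, Thm. 14.16] -/
theorem exists_cmGenerator_dichotomy_model {d : ℚ} (hd : d ≠ 0) :
    haveI hV : (⟨0, 36 * d, 0, -48 * d ^ 2, 16 * d ^ 3⟩ : WeierstrassCurve ℚ).IsElliptic :=
      ⟨isUnit_iff_ne_zero.mpr (by rw [Δ_model]; exact mul_ne_zero (by norm_num) (pow_ne_zero 6 hd))⟩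
    ∃ η : AddMonoid.End (geomPoints (⟨0, 36 * d, 0, -48 * d ^ 2, 16 * d ^ 3⟩ : WeierstrassCurve ℚ)),
      (∀ P, η (η P) + (9 : ℤ) • η P = (-27 : ℤ) • P) ∧
      ∀ σ : absoluteGaloisGroup ℚ,
        (∀ P, σ • η P = η (σ • P)) ∨ (∀ P, η (σ • P) = -(σ • η P) - (9 : ℤ) • σ • P) := by
  set V : WeierstrassCurve ℚ := ⟨0, 36 * d, 0, -48 * d ^ 2, 16 * d ^ 3⟩ with hVdef
  have hΔV0 : V.Δ ≠ 0 := by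
    rw [hVdef, Δ_model]; exact mul_ne_zero (by norm_num) (pow_ne_zero 6 hd)
  haveI hVell : V.IsElliptic := ⟨isUnit_iff_ne_zero.mpr hΔV0⟩
  have hpair : IsKernelXThreePair (36 * d) (-48 * d ^ 2) (16 * d ^ 3) V
      (kernelXThreeCodomain (36 * d) (-48 * d ^ 2) (16 * d ^ 3)) :=
    isKernelXThreePair_mk (by ring) hΔV0
  set V' : WeierstrassCurve ℚ := kernelXThreeCodomain (36 * d) (-48 * d ^ 2) (16 * d ^ 3) with hV'def
  haveI hV'ell : V'.IsElliptic := ⟨isUnit_iff_ne_zero.mpr hpair.Δ'_ne⟩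
  have hc4 : V'.c₄ = 0 := by
    simp only [hV'def, WeierstrassCurve.c₄, WeierstrassCurve.b₂, WeierstrassCurve.b₄,
      kernelXThreeCodomain_a₁, kernelXThreeCodomain_a₂, kernelXThreeCodomain_a₃,
      kernelXThreeCodomain_a₄]
    ring
  have hjV' : V'.j = 0 := by rw [j, hc4]; ring
  -- Cox's generator on `V'` (`j = 0`: `cmDiscr = -3`, `c = 3`): `η₀² + 3η₀ = -3`
  have hdV' : cmDiscr V'.j = -3 := by rw [hjV']; norm_num [cmDiscr]
  obtain ⟨η₀, hη₀mem, hrel₀⟩ := exists_cmGenerator_of_mem_maximalCMJInvariants V'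
    (by rw [hjV']; simp [maximalCMJInvariants]) (c := 3) (by rw [hdV']; norm_num)
  rw [hdV', neg_neg] at hrel₀
  have hrel₀' : ∀ Q : geomPoints V', η₀ (η₀ Q) + (3 : ℤ) • η₀ Q = (-3 : ℤ) • Q := rel_apply V' hrel₀
  have hdich₀ := dichotomy V' hη₀mem hrel₀
  -- Vélu's isogeny `φ : V → V'`
  have hsurj : Function.Surjective hpair.geomHom := hpair.toIsogeny_surjective
  have hker : ∀ P : geomPoints V, hpair.geomHom P = 0 → (3 : ℤ) • P = 0 := fun P hP ↦ by
    have h3 : ((3 : ℕ) : ℤ) • P = 0 :=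
      zsmul_eq_zero_of_mem_of_natCard_eq hpair.natCard_ker_toIsogeny ((AddMonoidHom.mem_ker).mpr hP)
    exact_mod_cast h3
  exact exists_generator_pullback V V' hpair.geomHom hsurj hker hpair.geomHom_smul
    (m₀ := 3) (c₀ := -3) (by norm_num) (by norm_num) hrel₀' hdich₀

/-- **A CM generator for `j = −12288000` with the Galois dichotomy, on any model over `ℚ`.** For every
elliptic curve `W/ℚ` with `j(W) = −12288000` there is an additive endomorphism `η` of `E(ℚ̄)` with
**`η(ηP) + 9·ηP = −27·P`** (`m = 9`, `c = −27`, both ODD — `2` is inert in the order `ℤ[3ζ₃]`) such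
that every `σ ∈ Γ_ℚ` either commutes with `η` or satisfies `η(σP) = −σ(ηP) − 9·σP` (`σησ⁻¹ = η̄`).
Transport of `exists_cmGenerator_dichotomy_model` along the `ℚ`-isomorphism `W ≅ E_d`
(`twistPointsIso`, §2 with `n = 1`). [cite: Lang1987, Ch. 10 §4, Remark] [cite: Cox2013, §7.B and Thm. 14.16] -/
theorem exists_cmGenerator_dichotomy_of_j_eq_neg_12288000 (hj : W.j = -12288000) :
    ∃ η : AddMonoid.End (geomPoints W),
      (∀ P : geomPoints W, η (η P) + (9 : ℤ) • η P = (-27 : ℤ) • P) ∧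
      ∀ σ : absoluteGaloisGroup ℚ,
        (∀ P : geomPoints W, σ • η P = η (σ • P)) ∨
          (∀ P : geomPoints W, η (σ • P) = -(σ • η P) - (9 : ℤ) • σ • P) := by
  obtain ⟨d, hd, C, hC⟩ := exists_variableChange_eq_model_of_j_eq_neg_12288000 W hj
  set V : WeierstrassCurve ℚ := ⟨0, 36 * d, 0, -48 * d ^ 2, 16 * d ^ 3⟩ with hVdef
  have hΔV0 : V.Δ ≠ 0 := by
    rw [hVdef, Δ_model]; exact mul_ne_zero (by norm_num) (pow_ne_zero 6 hd)
  haveI hVell : V.IsElliptic := ⟨isUnit_iff_ne_zero.mpr hΔV0⟩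
  obtain ⟨ηV, hrelV, hdichV⟩ := exists_cmGenerator_dichotomy_model hd
  -- transport along `ι : E(ℚ̄) ≃ E_d(ℚ̄)` (an onto equivariant hom with trivial kernel: §2, `n = 1`)
  have hsurj : Function.Surjective (twistPointsIso hC).toAddMonoidHom := (twistPointsIso hC).surjective
  have hker : ∀ P : geomPoints W, (twistPointsIso hC).toAddMonoidHom P = 0 → (1 : ℤ) • P = 0 :=
    fun P hP ↦ by rw [one_zsmul]; exact (twistPointsIso hC).map_eq_zero_iff.mp hP
  exact exists_generator_pullback W V (twistPointsIso hC).toAddMonoidHom hsurj hker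
    (fun γ Q ↦ twistPointsIso_smul hC γ Q) (m₀ := 9) (c₀ := -27) (by norm_num) (by norm_num)
    hrelV hdichV

/-- **`Δ(W) < 0` for `j(W) = −12288000`** (`Δ(E_d) = −2¹²·3⁵·d⁶` and `Δ` changes by `u¹²` under a
`ℚ`-isomorphism). [cite: SilvermanAEC2009, III.§1 (Table 3.1)] -/
theorem Δ_neg_of_j_eq_neg_12288000 (hj : W.j = -12288000) : W.Δ < 0 := by
  obtain ⟨d, hd, C, hC⟩ := exists_variableChange_eq_model_of_j_eq_neg_12288000 W hj
  have h := congrArg WeierstrassCurve.Δ hC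
  rw [variableChange_Δ, Δ_model] at h
  -- `u⁻¹ ^ 12 * Δ(W) = -995328 d⁶`
  have hu : (0 : ℚ) < ((C.u⁻¹ : ℚˣ) : ℚ) ^ 12 := Even.pow_pos (by decide) (Units.ne_zero _)
  have hd6 : (0 : ℚ) < d ^ 6 := Even.pow_pos (by decide) hd
  by_contra hge
  rw [not_lt] at hge
  have h1 : (0 : ℚ) ≤ ((C.u⁻¹ : ℚˣ) : ℚ) ^ 12 * W.Δ := mul_nonneg hu.le hge
  rw [h] at h1
  nlinarith

end Rational

/-! ## §4 Base change to a number field containing `√Δ`: the EQUIVARIANT generator -/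

section BaseChange

variable (W : WeierstrassCurve ℚ) [W.IsElliptic]

/-- **An equivariant CM generator over `K ∋ √Δ` for `j = −12288000`.** For `W/ℚ` with
`j(W) = −12288000` and a number field `K` with `Δ_W ∈ K^{×2}`: there is an additive endomorphism `η`
of `E_K(K̄)` with `η(ηP) + 9·ηP = −27·P` commuting with EVERY element of `Γ_K` (`Γ_K` acts
`ℤ[η]`-linearly on each `E_K[2^M]`, i.e. through the Cartan of the order `ℤ[3ζ₃]`). Every `γ ∈ Γ_K` is
even on `E[2]` (`smul_trivial_or_fixedPointFree_of_isSquare_Δ`), and even elements commute with `η` by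
the dichotomy (`commute_of_trivial` / `commute_of_fixedPointFree`); transport along `E(ℚ̄) ≃ E_K(K̄)`.
The `j = −12288000` twin of `InertOrderSplittingHabitat.exists_cmGenerator_baseChange`.
[cite: Lang1987, Ch. 10 §4, Remark] [cite: DokchitserDokchitserMathZ2012, Theorem (1)] -/
theorem exists_cmGenerator_baseChange_of_j_eq_neg_12288000 (hj : W.j = -12288000)
    (K : Type) [Field K] [NumberField K] (hΔ : IsSquare (W.baseChange K).Δ) :
    ∃ η : AddMonoid.End (geomPoints (W.baseChange K)),
      (∀ P : geomPoints (W.baseChange K), η (η P) + (9 : ℤ) • η P = (-27 : ℤ) • P) ∧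
      (∀ (γ : absoluteGaloisGroup K) (P : geomPoints (W.baseChange K)), γ • η P = η (γ • P)) := by
  haveI : (W.baseChange K).IsElliptic := by rw [baseChange]; infer_instance
  obtain ⟨η₀, hrel, hdich⟩ := exists_cmGenerator_dichotomy_of_j_eq_neg_12288000 W hj
  have hcard : Nat.card (geomTorsion W ((2 : ℕ) : ℤ)) = 4 := by simpa using natCard_geomTorsion_two_pow W 1
  have h9 : Odd (9 : ℤ) := by decide
  have h27 : Odd (-27 : ℤ) := by decide
  obtain ⟨e, he⟩ := WeierstrassCurve.exists_addEquiv_geomPoints_baseChange W K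
  have he' : ∀ (γ : absoluteGaloisGroup K) (Q : geomPoints (W.baseChange K)),
      e.symm (γ • Q) = absGaloisRestrict ℚ K γ • e.symm Q := fun γ Q ↦ by
    apply e.injective
    rw [he, AddEquiv.apply_symm_apply, AddEquiv.apply_symm_apply]
  refine ⟨(e : geomPoints W →+ geomPoints (W.baseChange K)).comp
      (η₀.comp (e.symm : geomPoints (W.baseChange K) →+ geomPoints W)), fun P ↦ ?_, fun γ P ↦ ?_⟩
  · change e (η₀ (e.symm (e (η₀ (e.symm P))))) + (9 : ℤ) • e (η₀ (e.symm P)) = (-27 : ℤ) • P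
    rw [AddEquiv.symm_apply_apply, ← map_zsmul, ← map_add, hrel, map_zsmul, AddEquiv.apply_symm_apply]
  · change γ • e (η₀ (e.symm P)) = e (η₀ (e.symm (γ • P)))
    have h2K : (2 : K) ≠ 0 := two_ne_zero
    have hcomm : ∀ R : geomPoints W,
        absGaloisRestrict ℚ K γ • η₀ R = η₀ (absGaloisRestrict ℚ K γ • R) := by
      rcases smul_trivial_or_fixedPointFree_of_isSquare_Δ (W.baseChange K) h2K hΔ γ with htriv | hfpf
      · refine commute_of_trivial h9 hcard (hdich _) fun R h2R ↦ ?_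
        apply e.injective
        rw [he, htriv _ (by rw [← map_zsmul, h2R, map_zero])]
      · refine commute_of_fixedPointFree hrel h9 h27 hcard (hdich _) fun R h2R hfix ↦ ?_
        have h : e R = 0 := hfpf (e R) (by rw [← map_zsmul, h2R, map_zero]) (by rw [← he, hfix])
        exact e.injective (by rw [h, map_zero])
    rw [← he, hcomm, ← he']

end BaseChange

end Summit.BirchSwinnertonDyer.Rank1Residual.P2.CartanAtTwo

end
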